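import Literature.Barriers.CriticalPhenomena.PlaquetteWalkHoleRootInteriorRingBoxes
import Literature.Barriers.CriticalPhenomena.PlaquetteWalkHoleRootThinSide
import HarnessLib

/-!
# Barrier catalogue (SAWScalingLimit): LAW L OFF THE WALL — no ring cell that is an interior cell of the box kills a
route, wherever the hole sits (`≥ 2` from the walls); four mixed-position witnesses

Leaf of `PlaquetteWalkHoleRootInteriorRingBoxes` (the interior assembly: hole `≥ 3` from every wall; `not_killed_of_witnesses`,
`rootedFace_hroot_boxMinus_cell`) and `PlaquetteWalkHoleRootThinSide` (the schema leaf's witnesses on their own 16/17-cell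
blocks `overBlockW/E`, `underBlockW/E`). The interior assembly required the hole's whole `7 × 7` neighbourhood inside the
box. When the hole is at distance EXACTLY `2` from one or two walls, the ring cells ON those walls empty or mark routes
(`PlaquetteWalkHoleRootLawLWalls`), but the ring cells OFF the wall should still kill nothing — and the frame available
for witnesses is cut on the wall side(s). Checking every (off-wall ring cell, witness type) pair against the TIGHTEST frame
the walls can leave (the cell's own side of the `5 × 5` neighbourhood open, the three others cut), the landed blocks
(`westBlock`, `eastBlock`, `interiorBlock*`, `overBlock*`, `underBlock*`, `ringBlock*`) serve all pairs but eight: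
under `w₂`-free avoiding the bottom cells `(2,0)`, `(3,0)`, `(4,0)` with the west, east and north sides cut; over
`w₁`-free avoiding `(2,4)`, `(3,4)`, `(4,4)` (mirror); under `w₂`-free avoiding the pocket `(1,1)` and over `w₁`-free
avoiding `(1,3)` with the east, south and north sides cut. The lane's kit job j290510 finds a 20-arc free wound witness for
each of the four (cells, type) groups inside its tight frame; §2 certifies them at the reference position and transports
them to every position (the `PlaquetteWalkHoleRootInteriorNoKill` pattern, `exists_wound_witness_shift`).

* §1–§2 the four witnesses `mixBlockUS2s` (`[1,5]×[−1,3]`), `mixBlockUS2w` (`[0,5]×[0,3]`), `mixBlockON1n` (`[1,5]×[1,5]`),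
  `mixBlockON1w` (`[0,5]×[1,4]`) and ★★★ `exists_{under,over}_{W2FreeOff,W1FreeOff}_of_mixBlock…` (every position).
* §3 `block_hroot_subset_boxMinus_of_bounds` (a reference block with bounds `[x0,x1]×[y0,y1]` sits in the box when the hole
  leaves that much room); ★★★★★ `lawL_box_ring_offWall_not_killed` — hole `≥ 2` from every wall, a ring cell other than
  `farWW` that is NOT a boundary cell of the box removed alone ⇒ none of the four kills, every `θ` (60 (cell, type) block
  choices, table in the docstring); ★★★★★ `lawL_box_offWall_not_killed` — the same for any single cell at Chebyshev
  distance `≥ 2` other than `farWW`, off the wall or at distance `≥ 3`.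

With `PlaquetteWalkHoleRootLawLWalls` (ring cells ON a wall), `lawL_box_farWW_eq_zero` and `PlaquetteWalkHoleRootLawLDichotomy`
this is LAW L for every hole at distance `≥ 2` from the walls and every single removal at distance `≥ 2` from the hole:
the removal acts iff the cell is `farWW` or a ring cell on a wall.

Not in print; venture lane «pcv-sawmu», seat b-step0 gen 27 (FINDING-YB-KILL-FORCED-ZEROS §21).

References: A. Glazman, I. Manolescu, arXiv:1708.00395v3, §1 (Fig. 1, Fig. 2, the remark after eq. (1)), §2.1, §4.2
(translation invariance) and Lemma 2.1 [GlazmanManolescu2019]; A. Glazman, Electron. Commun. Probab. 20 (2015) no. 86,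
Lemma 3.1, proof pp. 6–7 [Glazman2015WeightedSAW]; R. Courant, H. Robbins, *What is Mathematics?* (1941/1958), Ch. V
Appendix §2 (the even–odd rule) [CourantRobbins1958].
-/

noncomputable section

open Set Function Complex

namespace Literature.Barriers.CriticalPhenomena.PlaquetteWalk

open Literature.Probability.RandomPlanarGeometry.SAW.YangBaxter
open Real Complex

/-! ## §1–§2 The four mixed-position witnesses: reference position, certificates, every position -/

section Witnesses

/-- Mixed-position witness block `US2s`: the 20 cells of an under w₂-free wound witness (reference root `(4, 2)`, hole
`(3, 2)`, far cell `(2, 2)`) AVOIDING the three bottom ring cells `(2, 0)`, `(3, 0)`, `(4, 0)`, inside the frame `[1,5]×[−1,4]` (west, east and north sides cut) (kit j290510 of the lane).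
[cite: GlazmanManolescu2019, §2.1 (finite domains of faces)] -/
def mixBlockUS2s42 : List Face := [(1,-1),(1,0),(1,1),(1,2),(2,-1),(2,1),(2,2),(2,3),(3,-1),(3,1),(3,3),(4,-1),(4,1),(4,2),(4,3),(5,-1),(5,0),(5,1),(5,2),(5,3)]

/-- Its mid-edges (20 arcs). [cite: GlazmanManolescu2019, §1 (definition of the model), Fig. 1] -/
def mixUS2sMids : List MidEdge :=
  [.vert 4 2, .slant 4 2, .vert 4 1, .vert 3 1, .slant 2 2, .vert 2 2, .slant 1 2, .slant 1 1, .slant 1 0, .vert 2 (-1), .vert 3 (-1), .vert 4 (-1), .vert 5 (-1), .slant 5 0, .slant 5 1, .slant 5 2, .slant 5 3, .vert 5 3, .vert 4 3, .vert 3 3, .slant 2 3]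

/-- The witness as a walk of its block. [cite: GlazmanManolescu2019, §1 (definition of the model), Fig. 1] -/
def mixUS2sWalk : YBWalk (dom mixBlockUS2s42) (w42.side .W) ((farW w42).side .N) where
  mids := mixUS2sMids
  head_eq := by decide
  getLast_eq := by decide
  nodup := by decide
  arc_mem := arc_mem_of_check (by decide)
  isChain := by decide
  noncross := noncross_of_check (by decide)

/-- The labelled witness. [cite: Glazman2015WeightedSAW, Lemma 3.1 (proof, pp. 6–7)] -/
def ωmixUS2s : ΩG (dom mixBlockUS2s42) (w42.side .W) (farW w42) := ⟨.N, mixUS2sWalk⟩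

/-- Certificates: first hit `4`, `20` arcs, no later far-cell arc, first side `S`, w₂-free off the far cell, odd
eastern-ray count (`1`). [cite: Glazman2015WeightedSAW, Lemma 3.1 (proof, pp. 6–7)] [cite: CourantRobbins1958, Ch. V Appendix §2 (the even–odd rule)] -/
theorem ωmixUS2s_cert : ωmixUS2s.2.firstHitG = 4 ∧ ωmixUS2s.2.arcs.length = 20 ∧
    (∀ j < 20, 4 < j → ωmixUS2s.2.fc j ≠ farW w42) ∧ ωmixUS2s.2.nth 4 = (farW w42).side .S ∧
    ωmixUS2s.2.W2FreeOff (farW w42) ∧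
    Odd ((Finset.range 16).filter fun j => eastRayB w42 (ωmixUS2s.2.nth (4 + j + 1)) = true).card := by
  refine ⟨by decide, by decide, by decide, by decide, by unfold YBWalk.W2FreeOff; decide, by decide⟩

/-- The block at the root plaquette `w`. [cite: GlazmanManolescu2019, §2.1, §4.2 (translation invariance)] -/
def mixBlockUS2s (w : Face) : List Face := mixBlockUS2s42.map (Face.shiftBy (refShift w))

/-- ★★★ The under w₂-free wound witness `US2s` at EVERY POSITION: any face list containing the translated block
carries a wound class-`B2a` under-walk at the far cell, w₂-free off it. [cite: GlazmanManolescu2019, §4.2 (translation invariance), Lemma 2.1]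
[cite: Glazman2015WeightedSAW, Lemma 3.1 (proof, pp. 6–7)] [cite: CourantRobbins1958, Ch. V Appendix §2 (the even–odd rule)] -/
theorem exists_under_W2FreeOff_of_mixBlockUS2s {Dl : List Face} {w : Face} (hB : ∀ c ∈ mixBlockUS2s w, c ∈ Dl)
    (hr : RootedFace (dom Dl) (w.side .W) (farW w)) (θ : ℝ) :
    ∃ (ω : ΩG (dom Dl) (w.side .W) (farW w)) (h : ω.IsB2a), ω.2.firstSideG = .S ∧
      ω.WE (fun _ => θ) ≠ excursionWinding θ ω.2.firstSideG (ω.z1 hr h) ω.1 ∧ ω.2.W2FreeOff (farW w) := by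
  have hB₀ := block42_mem_of_block_mem (B := mixBlockUS2s42) hB
  obtain ⟨hF, hn, hfc, hnth, hfree, hodd⟩ := ωmixUS2s_cert
  let ω₀ : ΩG (dom (Dl.map (Face.shiftBy (-refShift w)))) (w42.side .W) (farW w42) :=
    ⟨.N, mixUS2sWalk.mapDomain fun c hc => hB₀ c hc⟩
  have hF' : ω₀.2.firstHitG = 4 := hF
  have hn' : ω₀.2.arcs.length = 20 := hn
  have h₀ : ω₀.IsB2a := by
    refine ΩG.isB2a_of_forall_fc_ne (by rw [hF', hn']; omega) fun j hj1 hj2 => ?_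
    rw [hF'] at hj1
    rw [hn'] at hj2
    exact hfc j hj2 hj1
  have hM : ω₀.Mv = 16 := by unfold ΩG.Mv; rw [hF', hn']
  exact exists_wound_witness_shift (shiftBy_refShift_root w) (shiftBy_refShift_farW w) hr
    (fun γ r => γ.W2FreeOff r) (fun hm _ hf => YBWalk.W2FreeOff_of_mids_shift hm hf) ω₀ h₀
    (by rw [hF']; exact hnth) hfree (by rw [hM, hF']; exact hodd) θ

/-- Mixed-position witness block `US2w`: the 20 cells of an under w₂-free wound witness (reference root `(4, 2)`, hole
`(3, 2)`, far cell `(2, 2)`) AVOIDING the south-western pocket `(1, 1)`, inside the frame `[0,5]×[0,4]` (east, south and north sides cut) (kit j290510 of the lane).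
[cite: GlazmanManolescu2019, §2.1 (finite domains of faces)] -/
def mixBlockUS2w42 : List Face := [(0,0),(0,1),(0,2),(1,0),(1,2),(2,0),(2,1),(2,2),(2,3),(3,0),(3,1),(3,3),(4,0),(4,1),(4,2),(4,3),(5,0),(5,1),(5,2),(5,3)]

/-- Its mid-edges (20 arcs). [cite: GlazmanManolescu2019, §1 (definition of the model), Fig. 1] -/
def mixUS2wMids : List MidEdge :=
  [.vert 4 2, .slant 4 2, .vert 4 1, .vert 3 1, .slant 2 2, .vert 2 2, .vert 1 2, .slant 0 2, .slant 0 1, .vert 1 0, .vert 2 0, .vert 3 0, .vert 4 0, .vert 5 0, .slant 5 1, .slant 5 2, .slant 5 3, .vert 5 3, .vert 4 3, .vert 3 3, .slant 2 3]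

/-- The witness as a walk of its block. [cite: GlazmanManolescu2019, §1 (definition of the model), Fig. 1] -/
def mixUS2wWalk : YBWalk (dom mixBlockUS2w42) (w42.side .W) ((farW w42).side .N) where
  mids := mixUS2wMids
  head_eq := by decide
  getLast_eq := by decide
  nodup := by decide
  arc_mem := arc_mem_of_check (by decide)
  isChain := by decide
  noncross := noncross_of_check (by decide)

/-- The labelled witness. [cite: Glazman2015WeightedSAW, Lemma 3.1 (proof, pp. 6–7)] -/
def ωmixUS2w : ΩG (dom mixBlockUS2w42) (w42.side .W) (farW w42) := ⟨.N, mixUS2wWalk⟩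

/-- Certificates: first hit `4`, `20` arcs, no later far-cell arc, first side `S`, w₂-free off the far cell, odd
eastern-ray count (`1`). [cite: Glazman2015WeightedSAW, Lemma 3.1 (proof, pp. 6–7)] [cite: CourantRobbins1958, Ch. V Appendix §2 (the even–odd rule)] -/
theorem ωmixUS2w_cert : ωmixUS2w.2.firstHitG = 4 ∧ ωmixUS2w.2.arcs.length = 20 ∧
    (∀ j < 20, 4 < j → ωmixUS2w.2.fc j ≠ farW w42) ∧ ωmixUS2w.2.nth 4 = (farW w42).side .S ∧
    ωmixUS2w.2.W2FreeOff (farW w42) ∧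
    Odd ((Finset.range 16).filter fun j => eastRayB w42 (ωmixUS2w.2.nth (4 + j + 1)) = true).card := by
  refine ⟨by decide, by decide, by decide, by decide, by unfold YBWalk.W2FreeOff; decide, by decide⟩

/-- The block at the root plaquette `w`. [cite: GlazmanManolescu2019, §2.1, §4.2 (translation invariance)] -/
def mixBlockUS2w (w : Face) : List Face := mixBlockUS2w42.map (Face.shiftBy (refShift w))

/-- ★★★ The under w₂-free wound witness `US2w` at EVERY POSITION: any face list containing the translated block
carries a wound class-`B2a` under-walk at the far cell, w₂-free off it. [cite: GlazmanManolescu2019, §4.2 (translation invariance), Lemma 2.1]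
[cite: Glazman2015WeightedSAW, Lemma 3.1 (proof, pp. 6–7)] [cite: CourantRobbins1958, Ch. V Appendix §2 (the even–odd rule)] -/
theorem exists_under_W2FreeOff_of_mixBlockUS2w {Dl : List Face} {w : Face} (hB : ∀ c ∈ mixBlockUS2w w, c ∈ Dl)
    (hr : RootedFace (dom Dl) (w.side .W) (farW w)) (θ : ℝ) :
    ∃ (ω : ΩG (dom Dl) (w.side .W) (farW w)) (h : ω.IsB2a), ω.2.firstSideG = .S ∧
      ω.WE (fun _ => θ) ≠ excursionWinding θ ω.2.firstSideG (ω.z1 hr h) ω.1 ∧ ω.2.W2FreeOff (farW w) := by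
  have hB₀ := block42_mem_of_block_mem (B := mixBlockUS2w42) hB
  obtain ⟨hF, hn, hfc, hnth, hfree, hodd⟩ := ωmixUS2w_cert
  let ω₀ : ΩG (dom (Dl.map (Face.shiftBy (-refShift w)))) (w42.side .W) (farW w42) :=
    ⟨.N, mixUS2wWalk.mapDomain fun c hc => hB₀ c hc⟩
  have hF' : ω₀.2.firstHitG = 4 := hF
  have hn' : ω₀.2.arcs.length = 20 := hn
  have h₀ : ω₀.IsB2a := by
    refine ΩG.isB2a_of_forall_fc_ne (by rw [hF', hn']; omega) fun j hj1 hj2 => ?_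
    rw [hF'] at hj1
    rw [hn'] at hj2
    exact hfc j hj2 hj1
  have hM : ω₀.Mv = 16 := by unfold ΩG.Mv; rw [hF', hn']
  exact exists_wound_witness_shift (shiftBy_refShift_root w) (shiftBy_refShift_farW w) hr
    (fun γ r => γ.W2FreeOff r) (fun hm _ hf => YBWalk.W2FreeOff_of_mids_shift hm hf) ω₀ h₀
    (by rw [hF']; exact hnth) hfree (by rw [hM, hF']; exact hodd) θ

/-- Mixed-position witness block `ON1n`: the 20 cells of an over w₁-free wound witness (reference root `(4, 2)`, hole
`(3, 2)`, far cell `(2, 2)`) AVOIDING the three top ring cells `(2, 4)`, `(3, 4)`, `(4, 4)`, inside the frame `[1,5]×[0,5]` (west, east and south sides cut) (kit j290510 of the lane).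
[cite: GlazmanManolescu2019, §2.1 (finite domains of faces)] -/
def mixBlockON1n42 : List Face := [(1,2),(1,3),(1,4),(1,5),(2,1),(2,2),(2,3),(2,5),(3,1),(3,3),(3,5),(4,1),(4,2),(4,3),(4,5),(5,1),(5,2),(5,3),(5,4),(5,5)]

/-- Its mid-edges (20 arcs). [cite: GlazmanManolescu2019, §1 (definition of the model), Fig. 1] -/
def mixON1nMids : List MidEdge :=
  [.vert 4 2, .slant 4 3, .vert 4 3, .vert 3 3, .slant 2 3, .vert 2 2, .slant 1 3, .slant 1 4, .slant 1 5, .vert 2 5, .vert 3 5, .vert 4 5, .vert 5 5, .slant 5 5, .slant 5 4, .slant 5 3, .slant 5 2, .vert 5 1, .vert 4 1, .vert 3 1, .slant 2 2]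

/-- The witness as a walk of its block. [cite: GlazmanManolescu2019, §1 (definition of the model), Fig. 1] -/
def mixON1nWalk : YBWalk (dom mixBlockON1n42) (w42.side .W) ((farW w42).side .S) where
  mids := mixON1nMids
  head_eq := by decide
  getLast_eq := by decide
  nodup := by decide
  arc_mem := arc_mem_of_check (by decide)
  isChain := by decide
  noncross := noncross_of_check (by decide)

/-- The labelled witness. [cite: Glazman2015WeightedSAW, Lemma 3.1 (proof, pp. 6–7)] -/
def ωmixON1n : ΩG (dom mixBlockON1n42) (w42.side .W) (farW w42) := ⟨.S, mixON1nWalk⟩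

/-- Certificates: first hit `4`, `20` arcs, no later far-cell arc, first side `N`, w₁-free off the far cell, odd
eastern-ray count (`1`). [cite: Glazman2015WeightedSAW, Lemma 3.1 (proof, pp. 6–7)] [cite: CourantRobbins1958, Ch. V Appendix §2 (the even–odd rule)] -/
theorem ωmixON1n_cert : ωmixON1n.2.firstHitG = 4 ∧ ωmixON1n.2.arcs.length = 20 ∧
    (∀ j < 20, 4 < j → ωmixON1n.2.fc j ≠ farW w42) ∧ ωmixON1n.2.nth 4 = (farW w42).side .N ∧
    ωmixON1n.2.W1FreeOff (farW w42) ∧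
    Odd ((Finset.range 16).filter fun j => eastRayB w42 (ωmixON1n.2.nth (4 + j + 1)) = true).card := by
  refine ⟨by decide, by decide, by decide, by decide, by unfold YBWalk.W1FreeOff; decide, by decide⟩

/-- The block at the root plaquette `w`. [cite: GlazmanManolescu2019, §2.1, §4.2 (translation invariance)] -/
def mixBlockON1n (w : Face) : List Face := mixBlockON1n42.map (Face.shiftBy (refShift w))

/-- ★★★ The over w₁-free wound witness `ON1n` at EVERY POSITION: any face list containing the translated block
carries a wound class-`B2a` over-walk at the far cell, w₁-free off it. [cite: GlazmanManolescu2019, §4.2 (translation invariance), Lemma 2.1]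
[cite: Glazman2015WeightedSAW, Lemma 3.1 (proof, pp. 6–7)] [cite: CourantRobbins1958, Ch. V Appendix §2 (the even–odd rule)] -/
theorem exists_over_W1FreeOff_of_mixBlockON1n {Dl : List Face} {w : Face} (hB : ∀ c ∈ mixBlockON1n w, c ∈ Dl)
    (hr : RootedFace (dom Dl) (w.side .W) (farW w)) (θ : ℝ) :
    ∃ (ω : ΩG (dom Dl) (w.side .W) (farW w)) (h : ω.IsB2a), ω.2.firstSideG = .N ∧
      ω.WE (fun _ => θ) ≠ excursionWinding θ ω.2.firstSideG (ω.z1 hr h) ω.1 ∧ ω.2.W1FreeOff (farW w) := by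
  have hB₀ := block42_mem_of_block_mem (B := mixBlockON1n42) hB
  obtain ⟨hF, hn, hfc, hnth, hfree, hodd⟩ := ωmixON1n_cert
  let ω₀ : ΩG (dom (Dl.map (Face.shiftBy (-refShift w)))) (w42.side .W) (farW w42) :=
    ⟨.S, mixON1nWalk.mapDomain fun c hc => hB₀ c hc⟩
  have hF' : ω₀.2.firstHitG = 4 := hF
  have hn' : ω₀.2.arcs.length = 20 := hn
  have h₀ : ω₀.IsB2a := by
    refine ΩG.isB2a_of_forall_fc_ne (by rw [hF', hn']; omega) fun j hj1 hj2 => ?_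
    rw [hF'] at hj1
    rw [hn'] at hj2
    exact hfc j hj2 hj1
  have hM : ω₀.Mv = 16 := by unfold ΩG.Mv; rw [hF', hn']
  exact exists_wound_witness_shift (shiftBy_refShift_root w) (shiftBy_refShift_farW w) hr
    (fun γ r => γ.W1FreeOff r) (fun hm _ hf => YBWalk.W1FreeOff_of_mids_shift hm hf) ω₀ h₀
    (by rw [hF']; exact hnth) hfree (by rw [hM, hF']; exact hodd) θ

/-- Mixed-position witness block `ON1w`: the 20 cells of an over w₁-free wound witness (reference root `(4, 2)`, hole
`(3, 2)`, far cell `(2, 2)`) AVOIDING the north-western pocket `(1, 3)`, inside the frame `[0,5]×[0,4]` (east, south and north sides cut) (kit j290510 of the lane).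
[cite: GlazmanManolescu2019, §2.1 (finite domains of faces)] -/
def mixBlockON1w42 : List Face := [(0,2),(0,3),(0,4),(1,2),(1,4),(2,1),(2,2),(2,3),(2,4),(3,1),(3,3),(3,4),(4,1),(4,2),(4,3),(4,4),(5,1),(5,2),(5,3),(5,4)]

/-- Its mid-edges (20 arcs). [cite: GlazmanManolescu2019, §1 (definition of the model), Fig. 1] -/
def mixON1wMids : List MidEdge :=
  [.vert 4 2, .slant 4 3, .vert 4 3, .vert 3 3, .slant 2 3, .vert 2 2, .vert 1 2, .slant 0 3, .slant 0 4, .vert 1 4, .vert 2 4, .vert 3 4, .vert 4 4, .vert 5 4, .slant 5 4, .slant 5 3, .slant 5 2, .vert 5 1, .vert 4 1, .vert 3 1, .slant 2 2]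

/-- The witness as a walk of its block. [cite: GlazmanManolescu2019, §1 (definition of the model), Fig. 1] -/
def mixON1wWalk : YBWalk (dom mixBlockON1w42) (w42.side .W) ((farW w42).side .S) where
  mids := mixON1wMids
  head_eq := by decide
  getLast_eq := by decide
  nodup := by decide
  arc_mem := arc_mem_of_check (by decide)
  isChain := by decide
  noncross := noncross_of_check (by decide)

/-- The labelled witness. [cite: Glazman2015WeightedSAW, Lemma 3.1 (proof, pp. 6–7)] -/
def ωmixON1w : ΩG (dom mixBlockON1w42) (w42.side .W) (farW w42) := ⟨.S, mixON1wWalk⟩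

/-- Certificates: first hit `4`, `20` arcs, no later far-cell arc, first side `N`, w₁-free off the far cell, odd
eastern-ray count (`1`). [cite: Glazman2015WeightedSAW, Lemma 3.1 (proof, pp. 6–7)] [cite: CourantRobbins1958, Ch. V Appendix §2 (the even–odd rule)] -/
theorem ωmixON1w_cert : ωmixON1w.2.firstHitG = 4 ∧ ωmixON1w.2.arcs.length = 20 ∧
    (∀ j < 20, 4 < j → ωmixON1w.2.fc j ≠ farW w42) ∧ ωmixON1w.2.nth 4 = (farW w42).side .N ∧
    ωmixON1w.2.W1FreeOff (farW w42) ∧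
    Odd ((Finset.range 16).filter fun j => eastRayB w42 (ωmixON1w.2.nth (4 + j + 1)) = true).card := by
  refine ⟨by decide, by decide, by decide, by decide, by unfold YBWalk.W1FreeOff; decide, by decide⟩

/-- The block at the root plaquette `w`. [cite: GlazmanManolescu2019, §2.1, §4.2 (translation invariance)] -/
def mixBlockON1w (w : Face) : List Face := mixBlockON1w42.map (Face.shiftBy (refShift w))

/-- ★★★ The over w₁-free wound witness `ON1w` at EVERY POSITION: any face list containing the translated block
carries a wound class-`B2a` over-walk at the far cell, w₁-free off it. [cite: GlazmanManolescu2019, §4.2 (translation invariance), Lemma 2.1]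
[cite: Glazman2015WeightedSAW, Lemma 3.1 (proof, pp. 6–7)] [cite: CourantRobbins1958, Ch. V Appendix §2 (the even–odd rule)] -/
theorem exists_over_W1FreeOff_of_mixBlockON1w {Dl : List Face} {w : Face} (hB : ∀ c ∈ mixBlockON1w w, c ∈ Dl)
    (hr : RootedFace (dom Dl) (w.side .W) (farW w)) (θ : ℝ) :
    ∃ (ω : ΩG (dom Dl) (w.side .W) (farW w)) (h : ω.IsB2a), ω.2.firstSideG = .N ∧
      ω.WE (fun _ => θ) ≠ excursionWinding θ ω.2.firstSideG (ω.z1 hr h) ω.1 ∧ ω.2.W1FreeOff (farW w) := by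
  have hB₀ := block42_mem_of_block_mem (B := mixBlockON1w42) hB
  obtain ⟨hF, hn, hfc, hnth, hfree, hodd⟩ := ωmixON1w_cert
  let ω₀ : ΩG (dom (Dl.map (Face.shiftBy (-refShift w)))) (w42.side .W) (farW w42) :=
    ⟨.S, mixON1wWalk.mapDomain fun c hc => hB₀ c hc⟩
  have hF' : ω₀.2.firstHitG = 4 := hF
  have hn' : ω₀.2.arcs.length = 20 := hn
  have h₀ : ω₀.IsB2a := by
    refine ΩG.isB2a_of_forall_fc_ne (by rw [hF', hn']; omega) fun j hj1 hj2 => ?_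
    rw [hF'] at hj1
    rw [hn'] at hj2
    exact hfc j hj2 hj1
  have hM : ω₀.Mv = 16 := by unfold ΩG.Mv; rw [hF', hn']
  exact exists_wound_witness_shift (shiftBy_refShift_root w) (shiftBy_refShift_farW w) hr
    (fun γ r => γ.W1FreeOff r) (fun hm _ hf => YBWalk.W1FreeOff_of_mids_shift hm hf) ω₀ h₀
    (by rw [hF']; exact hnth) hfree (by rw [hM, hF']; exact hodd) θ

end Witnesses

/-! ## §3 No off-wall ring cell other than `farWW` kills a route — hole anywhere `≥ 2` from the walls -/

section OffWall

variable {m n : ℕ} {h : Face}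

/-- **A reference block with given bounds sits in the box.** If every cell of the reference block `B` (reference root
`(4, 2)`, hole `(3, 2)`) satisfies `x0 ≤ a.1 ≤ x1`, `y0 ≤ a.2 ≤ y1`, is not the hole and is not the reference cell
`(ex, ey)`, and the hole `h` of the `m × n` box leaves that much room (`3 ≤ x0 + h.1`, `x1 + h.1 ≤ m + 2`, `2 ≤ y0 + h.2`,
`y1 + h.2 ≤ n + 1`), then the translate of `B` to the root plaquette `(h.1 + 1, h.2)` lies in the box minus the hole and
the translate `(cx, cy) = (h.1 + ex − 3, h.2 + ey − 2)` of the reference cell (sharpens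
`block_hroot_subset_boxMinus_of_frame`). [cite: GlazmanManolescu2019, §2.1 (finite domains of faces), §4.2 (translation invariance)] -/
theorem block_hroot_subset_boxMinus_of_bounds (B : List Face) (x0 x1 y0 y1 ex ey : ℤ)
    (hB : ∀ a ∈ B, x0 ≤ a.1 ∧ a.1 ≤ x1 ∧ y0 ≤ a.2 ∧ a.2 ≤ y1 ∧ a ≠ (3, 2) ∧ a ≠ (ex, ey))
    (hW : 3 ≤ x0 + h.1) (hE : x1 + h.1 ≤ m + 2) (hS : 2 ≤ y0 + h.2) (hN : y1 + h.2 ≤ n + 1) {cx cy : ℤ}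
    (hc : cx = h.1 + ex - 3 ∧ cy = h.2 + ey - 2) :
    ∀ c ∈ B.map (Face.shiftBy (refShift (h.1 + 1, h.2))), c ∈ boxMinus m n [h, (cx, cy)] := by
  intro c hc'
  rw [List.mem_map] at hc'
  obtain ⟨a, ha, rfl⟩ := hc'
  obtain ⟨b1, b2, b3, b4, b5, b6⟩ := hB a ha
  obtain ⟨x, y⟩ := a
  simp only [ne_eq, Prod.mk.injEq, not_and] at b1 b2 b3 b4 b5 b6
  obtain ⟨hc1, hc2⟩ := hc
  rw [shiftBy_refShift_mk, mem_boxMinus]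
  simp only [List.mem_cons, List.not_mem_nil, or_false, not_or]
  refine ⟨⟨by omega, by omega, by omega, by omega⟩, fun e => ?_, fun e => ?_⟩
  · have e' := Prod.ext_iff.1 e; simp only at e'; omega
  · have e' := Prod.ext_iff.1 e; simp only at e'; omega

/-- ★★★★★ **LAW L: NO RING CELL OFF THE WALL OTHER THAN `farWW` KILLS A ROUTE — the hole anywhere at distance `≥ 2` from
the walls.** In the `m × n` box with the hole `h` at distance `≥ 2` from every wall, remove the hole and ONE cell `(x, y)`
of the boundary ring of the hole's closed `5 × 5` neighbourhood, other than the far cell's outer neighbour `(h.1 − 2, h.2)`,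
which is NOT a boundary cell of the box (`1 ≤ x ≤ m − 2`, `1 ≤ y ≤ n − 2`). Then at every angle NONE of the four universal
kill statements of LAW L holds at the far cell of the root plaquette `(h.1 + 1, h.2)` (sharpens `lawL_box_ring_not_killed`,
which needs the hole `≥ 3` from every wall). For each of the fifteen cells and each witness type a landed every-position
block is named that avoids the cell AND fits the tightest frame the walls can leave (the cell's own side open — it is off
the wall — every other side of the `5 × 5` neighbourhood possibly ON the wall); the eight (cell, type) pairs no older block
serves in that frame are the four witnesses of §2 (kit j290510). Table (reference coordinates, hole `(3, 2)`; under
`w₂`-free / over `w₁`-free / under `w₁`-free / over `w₂`-free): `(1,0)`: ISW · OE · W · W; `(1,1)`: US2w · OE · US1c · OW;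
`(1,3)`: UE · ON1w · UW · ON2c; `(1,4)`: UE · INW · W · W; `(2,0)`, `(3,0)`, `(4,0)`: US2s · OE · US1a · OW; `(2,4)`, `(3,4)`,
`(4,4)`: UE · ON1n · UW · ON2a; `(5,0)`: E · E · ISE · OW; `(5,1)`: US2a · ON1a · US1b · OW; `(5,2)`: US2a · ON1a · US1b · ON2b;
`(5,3)`: US2a · ON1a · UW · ON2b; `(5,4)`: E · E · UW · INE (`W`/`E` = `westBlock`/`eastBlock`, `ISW…INE` = `interiorBlock…`,
`OW/OE/UW/UE` = `overBlockW/E`, `underBlockW/E`, `US2s…ON1w` = `mixBlock…`, the rest `ringBlock…`).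
[cite: GlazmanManolescu2019, §1 (Fig. 2 and the remark after eq. (1)), §2.1, §4.2, Lemma 2.1]
[cite: Glazman2015WeightedSAW, Lemma 3.1 (proof, pp. 6–7)] [cite: CourantRobbins1958, Ch. V Appendix §2 (the even–odd rule)] -/
theorem lawL_box_ring_offWall_not_killed (hW : 2 ≤ h.1) (hE : h.1 + 3 ≤ m) (hS : 2 ≤ h.2) (hN : h.2 + 3 ≤ n) {x y : ℤ}
    (hring : ((x = h.1 - 2 ∨ x = h.1 + 2) ∧ h.2 - 2 ≤ y ∧ y ≤ h.2 + 2) ∨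
      ((y = h.2 - 2 ∨ y = h.2 + 2) ∧ h.1 - 2 ≤ x ∧ x ≤ h.1 + 2))
    (hWW : ¬(x = h.1 - 2 ∧ y = h.2)) (hoff : 1 ≤ x ∧ x + 2 ≤ m ∧ 1 ≤ y ∧ y + 2 ≤ n)
    (hr : RootedFace (dom (boxMinus m n [h, (x, y)])) (Face.side (h.1 + 1, h.2) .W) (farW (h.1 + 1, h.2))) (θ : ℝ) :
    (¬ ∀ (ω : ΩG (dom (boxMinus m n [h, (x, y)])) (Face.side (h.1 + 1, h.2) .W) (farW (h.1 + 1, h.2))) (hb : ω.IsB2a),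
        ω.2.firstSideG = .S → ω.WE (fun _ => θ) ≠ excursionWinding θ ω.2.firstSideG (ω.z1 hr hb) ω.1 →
          ¬ω.2.W2FreeOff (farW (h.1 + 1, h.2))) ∧
      (¬ ∀ (ω : ΩG (dom (boxMinus m n [h, (x, y)])) (Face.side (h.1 + 1, h.2) .W) (farW (h.1 + 1, h.2))) (hb : ω.IsB2a),
        ω.2.firstSideG = .N → ω.WE (fun _ => θ) ≠ excursionWinding θ ω.2.firstSideG (ω.z1 hr hb) ω.1 →
          ¬ω.2.W1FreeOff (farW (h.1 + 1, h.2))) ∧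
      (¬ ∀ (ω : ΩG (dom (boxMinus m n [h, (x, y)])) (Face.side (h.1 + 1, h.2) .W) (farW (h.1 + 1, h.2))) (hb : ω.IsB2a),
        ω.2.firstSideG = .S → ω.WE (fun _ => θ) ≠ excursionWinding θ ω.2.firstSideG (ω.z1 hr hb) ω.1 →
          ¬ω.2.W1FreeOff (farW (h.1 + 1, h.2))) ∧
      (¬ ∀ (ω : ΩG (dom (boxMinus m n [h, (x, y)])) (Face.side (h.1 + 1, h.2) .W) (farW (h.1 + 1, h.2))) (hb : ω.IsB2a),
        ω.2.firstSideG = .N → ω.WE (fun _ => θ) ≠ excursionWinding θ ω.2.firstSideG (ω.z1 hr hb) ω.1 →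
          ¬ω.2.W2FreeOff (farW (h.1 + 1, h.2))) := by
  have sub := block_hroot_subset_boxMinus_of_bounds (m := m) (n := n) (h := h)
  obtain ⟨hx1, hx2, hy1, hy2⟩ := hoff
  rcases hring with ⟨hx, hy3, hy4⟩ | ⟨hy, hx3, hx4⟩
  · have hy : y = h.2 - 2 ∨ y = h.2 - 1 ∨ y = h.2 ∨ y = h.2 + 1 ∨ y = h.2 + 2 := by omega
    rcases hx with rfl | rfl
    · -- west column of the ring: reference cells (1,0), (1,1), [(1,2) = farWW excluded], (1,3), (1,4)
      rcases hy with rfl | rfl | rfl | rfl | rfl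
      · exact not_killed_of_witnesses hr θ
          (exists_under_w2free_of_interiorBlockSW (sub interiorBlockSW42 0 5 (-1) 3 1 0 (by decide) (by omega) (by omega)
            (by omega) (by omega) ⟨by omega, by omega⟩) hr θ)
          (exists_over_w1free_of_overBlockE (sub overBlockE42 1 5 1 4 1 0 (by decide) (by omega) (by omega)
            (by omega) (by omega) ⟨by omega, by omega⟩) hr θ)
          (exists_under_w1free_of_westBlock (sub westBlock42 1 5 0 4 1 0 (by decide) (by omega) (by omega)
            (by omega) (by omega) ⟨by omega, by omega⟩) hr θ)
          (exists_over_w2free_of_westBlock (sub westBlock42 1 5 0 4 1 0 (by decide) (by omega) (by omega)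
            (by omega) (by omega) ⟨by omega, by omega⟩) hr θ)
      · exact not_killed_of_witnesses hr θ
          (exists_under_W2FreeOff_of_mixBlockUS2w (sub mixBlockUS2w42 0 5 0 3 1 1 (by decide) (by omega) (by omega)
            (by omega) (by omega) ⟨by omega, by omega⟩) hr θ)
          (exists_over_w1free_of_overBlockE (sub overBlockE42 1 5 1 4 1 1 (by decide) (by omega) (by omega)
            (by omega) (by omega) ⟨by omega, by omega⟩) hr θ)
          (exists_under_W1FreeOff_of_ringBlockUS1c (sub ringBlockUS1c42 0 5 0 3 1 1 (by decide) (by omega) (by omega)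
            (by omega) (by omega) ⟨by omega, by omega⟩) hr θ)
          (exists_over_w2free_of_overBlockW (sub overBlockW42 1 5 1 4 1 1 (by decide) (by omega) (by omega)
            (by omega) (by omega) ⟨by omega, by omega⟩) hr θ)
      · exact absurd ⟨rfl, rfl⟩ hWW
      · exact not_killed_of_witnesses hr θ
          (exists_under_w2free_of_underBlockE (sub underBlockE42 1 5 0 3 1 3 (by decide) (by omega) (by omega)
            (by omega) (by omega) ⟨by omega, by omega⟩) hr θ)
          (exists_over_W1FreeOff_of_mixBlockON1w (sub mixBlockON1w42 0 5 1 4 1 3 (by decide) (by omega) (by omega)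
            (by omega) (by omega) ⟨by omega, by omega⟩) hr θ)
          (exists_under_w1free_of_underBlockW (sub underBlockW42 1 5 0 3 1 3 (by decide) (by omega) (by omega)
            (by omega) (by omega) ⟨by omega, by omega⟩) hr θ)
          (exists_over_W2FreeOff_of_ringBlockON2c (sub ringBlockON2c42 0 5 1 4 1 3 (by decide) (by omega) (by omega)
            (by omega) (by omega) ⟨by omega, by omega⟩) hr θ)
      · exact not_killed_of_witnesses hr θ
          (exists_under_w2free_of_underBlockE (sub underBlockE42 1 5 0 3 1 4 (by decide) (by omega) (by omega)
            (by omega) (by omega) ⟨by omega, by omega⟩) hr θ)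
          (exists_over_w1free_of_interiorBlockNW (sub interiorBlockNW42 0 5 1 5 1 4 (by decide) (by omega) (by omega)
            (by omega) (by omega) ⟨by omega, by omega⟩) hr θ)
          (exists_under_w1free_of_westBlock (sub westBlock42 1 5 0 4 1 4 (by decide) (by omega) (by omega)
            (by omega) (by omega) ⟨by omega, by omega⟩) hr θ)
          (exists_over_w2free_of_westBlock (sub westBlock42 1 5 0 4 1 4 (by decide) (by omega) (by omega)
            (by omega) (by omega) ⟨by omega, by omega⟩) hr θ)
    · -- east column of the ring: reference cells (5,0) … (5,4)
      rcases hy with rfl | rfl | rfl | rfl | rfl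
      · exact not_killed_of_witnesses hr θ
          (exists_under_w2free_of_eastBlock (sub eastBlock42 1 5 0 4 5 0 (by decide) (by omega) (by omega)
            (by omega) (by omega) ⟨by omega, by omega⟩) hr θ)
          (exists_over_w1free_of_eastBlock (sub eastBlock42 1 5 0 4 5 0 (by decide) (by omega) (by omega)
            (by omega) (by omega) ⟨by omega, by omega⟩) hr θ)
          (exists_under_w1free_of_interiorBlockSE (sub interiorBlockSE42 1 6 (-1) 3 5 0 (by decide) (by omega) (by omega)
            (by omega) (by omega) ⟨by omega, by omega⟩) hr θ)
          (exists_over_w2free_of_overBlockW (sub overBlockW42 1 5 1 4 5 0 (by decide) (by omega) (by omega)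
            (by omega) (by omega) ⟨by omega, by omega⟩) hr θ)
      · exact not_killed_of_witnesses hr θ
          (exists_under_W2FreeOff_of_ringBlockUS2a (sub ringBlockUS2a42 1 6 0 4 5 1 (by decide) (by omega) (by omega)
            (by omega) (by omega) ⟨by omega, by omega⟩) hr θ)
          (exists_over_W1FreeOff_of_ringBlockON1a (sub ringBlockON1a42 1 6 0 4 5 1 (by decide) (by omega) (by omega)
            (by omega) (by omega) ⟨by omega, by omega⟩) hr θ)
          (exists_under_W1FreeOff_of_ringBlockUS1b (sub ringBlockUS1b42 1 6 0 3 5 1 (by decide) (by omega) (by omega)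
            (by omega) (by omega) ⟨by omega, by omega⟩) hr θ)
          (exists_over_w2free_of_overBlockW (sub overBlockW42 1 5 1 4 5 1 (by decide) (by omega) (by omega)
            (by omega) (by omega) ⟨by omega, by omega⟩) hr θ)
      · exact not_killed_of_witnesses hr θ
          (exists_under_W2FreeOff_of_ringBlockUS2a (sub ringBlockUS2a42 1 6 0 4 5 2 (by decide) (by omega) (by omega)
            (by omega) (by omega) ⟨by omega, by omega⟩) hr θ)
          (exists_over_W1FreeOff_of_ringBlockON1a (sub ringBlockON1a42 1 6 0 4 5 2 (by decide) (by omega) (by omega)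
            (by omega) (by omega) ⟨by omega, by omega⟩) hr θ)
          (exists_under_W1FreeOff_of_ringBlockUS1b (sub ringBlockUS1b42 1 6 0 3 5 2 (by decide) (by omega) (by omega)
            (by omega) (by omega) ⟨by omega, by omega⟩) hr θ)
          (exists_over_W2FreeOff_of_ringBlockON2b (sub ringBlockON2b42 1 6 1 4 5 2 (by decide) (by omega) (by omega)
            (by omega) (by omega) ⟨by omega, by omega⟩) hr θ)
      · exact not_killed_of_witnesses hr θ
          (exists_under_W2FreeOff_of_ringBlockUS2a (sub ringBlockUS2a42 1 6 0 4 5 3 (by decide) (by omega) (by omega)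
            (by omega) (by omega) ⟨by omega, by omega⟩) hr θ)
          (exists_over_W1FreeOff_of_ringBlockON1a (sub ringBlockON1a42 1 6 0 4 5 3 (by decide) (by omega) (by omega)
            (by omega) (by omega) ⟨by omega, by omega⟩) hr θ)
          (exists_under_w1free_of_underBlockW (sub underBlockW42 1 5 0 3 5 3 (by decide) (by omega) (by omega)
            (by omega) (by omega) ⟨by omega, by omega⟩) hr θ)
          (exists_over_W2FreeOff_of_ringBlockON2b (sub ringBlockON2b42 1 6 1 4 5 3 (by decide) (by omega) (by omega)
            (by omega) (by omega) ⟨by omega, by omega⟩) hr θ)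
      · exact not_killed_of_witnesses hr θ
          (exists_under_w2free_of_eastBlock (sub eastBlock42 1 5 0 4 5 4 (by decide) (by omega) (by omega)
            (by omega) (by omega) ⟨by omega, by omega⟩) hr θ)
          (exists_over_w1free_of_eastBlock (sub eastBlock42 1 5 0 4 5 4 (by decide) (by omega) (by omega)
            (by omega) (by omega) ⟨by omega, by omega⟩) hr θ)
          (exists_under_w1free_of_underBlockW (sub underBlockW42 1 5 0 3 5 4 (by decide) (by omega) (by omega)
            (by omega) (by omega) ⟨by omega, by omega⟩) hr θ)
          (exists_over_w2free_of_interiorBlockNE (sub interiorBlockNE42 1 6 1 5 5 4 (by decide) (by omega) (by omega)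
            (by omega) (by omega) ⟨by omega, by omega⟩) hr θ)
  · have hx : x = h.1 - 2 ∨ x = h.1 - 1 ∨ x = h.1 ∨ x = h.1 + 1 ∨ x = h.1 + 2 := by omega
    rcases hy with rfl | rfl
    · -- bottom row of the ring: reference cells (1,0) … (5,0)
      rcases hx with rfl | rfl | rfl | rfl | rfl
      · exact not_killed_of_witnesses hr θ
          (exists_under_w2free_of_interiorBlockSW (sub interiorBlockSW42 0 5 (-1) 3 1 0 (by decide) (by omega) (by omega)
            (by omega) (by omega) ⟨by omega, by omega⟩) hr θ)
          (exists_over_w1free_of_overBlockE (sub overBlockE42 1 5 1 4 1 0 (by decide) (by omega) (by omega)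
            (by omega) (by omega) ⟨by omega, by omega⟩) hr θ)
          (exists_under_w1free_of_westBlock (sub westBlock42 1 5 0 4 1 0 (by decide) (by omega) (by omega)
            (by omega) (by omega) ⟨by omega, by omega⟩) hr θ)
          (exists_over_w2free_of_westBlock (sub westBlock42 1 5 0 4 1 0 (by decide) (by omega) (by omega)
            (by omega) (by omega) ⟨by omega, by omega⟩) hr θ)
      · exact not_killed_of_witnesses hr θ
          (exists_under_W2FreeOff_of_mixBlockUS2s (sub mixBlockUS2s42 1 5 (-1) 3 2 0 (by decide) (by omega) (by omega)
            (by omega) (by omega) ⟨by omega, by omega⟩) hr θ)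
          (exists_over_w1free_of_overBlockE (sub overBlockE42 1 5 1 4 2 0 (by decide) (by omega) (by omega)
            (by omega) (by omega) ⟨by omega, by omega⟩) hr θ)
          (exists_under_W1FreeOff_of_ringBlockUS1a (sub ringBlockUS1a42 1 5 (-1) 3 2 0 (by decide) (by omega) (by omega)
            (by omega) (by omega) ⟨by omega, by omega⟩) hr θ)
          (exists_over_w2free_of_overBlockW (sub overBlockW42 1 5 1 4 2 0 (by decide) (by omega) (by omega)
            (by omega) (by omega) ⟨by omega, by omega⟩) hr θ)
      · exact not_killed_of_witnesses hr θ
          (exists_under_W2FreeOff_of_mixBlockUS2s (sub mixBlockUS2s42 1 5 (-1) 3 3 0 (by decide) (by omega) (by omega)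
            (by omega) (by omega) ⟨by omega, by omega⟩) hr θ)
          (exists_over_w1free_of_overBlockE (sub overBlockE42 1 5 1 4 3 0 (by decide) (by omega) (by omega)
            (by omega) (by omega) ⟨by omega, by omega⟩) hr θ)
          (exists_under_W1FreeOff_of_ringBlockUS1a (sub ringBlockUS1a42 1 5 (-1) 3 3 0 (by decide) (by omega) (by omega)
            (by omega) (by omega) ⟨by omega, by omega⟩) hr θ)
          (exists_over_w2free_of_overBlockW (sub overBlockW42 1 5 1 4 3 0 (by decide) (by omega) (by omega)
            (by omega) (by omega) ⟨by omega, by omega⟩) hr θ)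
      · exact not_killed_of_witnesses hr θ
          (exists_under_W2FreeOff_of_mixBlockUS2s (sub mixBlockUS2s42 1 5 (-1) 3 4 0 (by decide) (by omega) (by omega)
            (by omega) (by omega) ⟨by omega, by omega⟩) hr θ)
          (exists_over_w1free_of_overBlockE (sub overBlockE42 1 5 1 4 4 0 (by decide) (by omega) (by omega)
            (by omega) (by omega) ⟨by omega, by omega⟩) hr θ)
          (exists_under_W1FreeOff_of_ringBlockUS1a (sub ringBlockUS1a42 1 5 (-1) 3 4 0 (by decide) (by omega) (by omega)
            (by omega) (by omega) ⟨by omega, by omega⟩) hr θ)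
          (exists_over_w2free_of_overBlockW (sub overBlockW42 1 5 1 4 4 0 (by decide) (by omega) (by omega)
            (by omega) (by omega) ⟨by omega, by omega⟩) hr θ)
      · exact not_killed_of_witnesses hr θ
          (exists_under_w2free_of_eastBlock (sub eastBlock42 1 5 0 4 5 0 (by decide) (by omega) (by omega)
            (by omega) (by omega) ⟨by omega, by omega⟩) hr θ)
          (exists_over_w1free_of_eastBlock (sub eastBlock42 1 5 0 4 5 0 (by decide) (by omega) (by omega)
            (by omega) (by omega) ⟨by omega, by omega⟩) hr θ)
          (exists_under_w1free_of_interiorBlockSE (sub interiorBlockSE42 1 6 (-1) 3 5 0 (by decide) (by omega) (by omega)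
            (by omega) (by omega) ⟨by omega, by omega⟩) hr θ)
          (exists_over_w2free_of_overBlockW (sub overBlockW42 1 5 1 4 5 0 (by decide) (by omega) (by omega)
            (by omega) (by omega) ⟨by omega, by omega⟩) hr θ)
    · -- top row of the ring: reference cells (1,4) … (5,4)
      rcases hx with rfl | rfl | rfl | rfl | rfl
      · exact not_killed_of_witnesses hr θ
          (exists_under_w2free_of_underBlockE (sub underBlockE42 1 5 0 3 1 4 (by decide) (by omega) (by omega)
            (by omega) (by omega) ⟨by omega, by omega⟩) hr θ)
          (exists_over_w1free_of_interiorBlockNW (sub interiorBlockNW42 0 5 1 5 1 4 (by decide) (by omega) (by omega)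
            (by omega) (by omega) ⟨by omega, by omega⟩) hr θ)
          (exists_under_w1free_of_westBlock (sub westBlock42 1 5 0 4 1 4 (by decide) (by omega) (by omega)
            (by omega) (by omega) ⟨by omega, by omega⟩) hr θ)
          (exists_over_w2free_of_westBlock (sub westBlock42 1 5 0 4 1 4 (by decide) (by omega) (by omega)
            (by omega) (by omega) ⟨by omega, by omega⟩) hr θ)
      · exact not_killed_of_witnesses hr θ
          (exists_under_w2free_of_underBlockE (sub underBlockE42 1 5 0 3 2 4 (by decide) (by omega) (by omega)
            (by omega) (by omega) ⟨by omega, by omega⟩) hr θ)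
          (exists_over_W1FreeOff_of_mixBlockON1n (sub mixBlockON1n42 1 5 1 5 2 4 (by decide) (by omega) (by omega)
            (by omega) (by omega) ⟨by omega, by omega⟩) hr θ)
          (exists_under_w1free_of_underBlockW (sub underBlockW42 1 5 0 3 2 4 (by decide) (by omega) (by omega)
            (by omega) (by omega) ⟨by omega, by omega⟩) hr θ)
          (exists_over_W2FreeOff_of_ringBlockON2a (sub ringBlockON2a42 1 5 1 5 2 4 (by decide) (by omega) (by omega)
            (by omega) (by omega) ⟨by omega, by omega⟩) hr θ)
      · exact not_killed_of_witnesses hr θ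
          (exists_under_w2free_of_underBlockE (sub underBlockE42 1 5 0 3 3 4 (by decide) (by omega) (by omega)
            (by omega) (by omega) ⟨by omega, by omega⟩) hr θ)
          (exists_over_W1FreeOff_of_mixBlockON1n (sub mixBlockON1n42 1 5 1 5 3 4 (by decide) (by omega) (by omega)
            (by omega) (by omega) ⟨by omega, by omega⟩) hr θ)
          (exists_under_w1free_of_underBlockW (sub underBlockW42 1 5 0 3 3 4 (by decide) (by omega) (by omega)
            (by omega) (by omega) ⟨by omega, by omega⟩) hr θ)
          (exists_over_W2FreeOff_of_ringBlockON2a (sub ringBlockON2a42 1 5 1 5 3 4 (by decide) (by omega) (by omega)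
            (by omega) (by omega) ⟨by omega, by omega⟩) hr θ)
      · exact not_killed_of_witnesses hr θ
          (exists_under_w2free_of_underBlockE (sub underBlockE42 1 5 0 3 4 4 (by decide) (by omega) (by omega)
            (by omega) (by omega) ⟨by omega, by omega⟩) hr θ)
          (exists_over_W1FreeOff_of_mixBlockON1n (sub mixBlockON1n42 1 5 1 5 4 4 (by decide) (by omega) (by omega)
            (by omega) (by omega) ⟨by omega, by omega⟩) hr θ)
          (exists_under_w1free_of_underBlockW (sub underBlockW42 1 5 0 3 4 4 (by decide) (by omega) (by omega)
            (by omega) (by omega) ⟨by omega, by omega⟩) hr θ)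
          (exists_over_W2FreeOff_of_ringBlockON2a (sub ringBlockON2a42 1 5 1 5 4 4 (by decide) (by omega) (by omega)
            (by omega) (by omega) ⟨by omega, by omega⟩) hr θ)
      · exact not_killed_of_witnesses hr θ
          (exists_under_w2free_of_eastBlock (sub eastBlock42 1 5 0 4 5 4 (by decide) (by omega) (by omega)
            (by omega) (by omega) ⟨by omega, by omega⟩) hr θ)
          (exists_over_w1free_of_eastBlock (sub eastBlock42 1 5 0 4 5 4 (by decide) (by omega) (by omega)
            (by omega) (by omega) ⟨by omega, by omega⟩) hr θ)
          (exists_under_w1free_of_underBlockW (sub underBlockW42 1 5 0 3 5 4 (by decide) (by omega) (by omega)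
            (by omega) (by omega) ⟨by omega, by omega⟩) hr θ)
          (exists_over_w2free_of_interiorBlockNE (sub interiorBlockNE42 1 6 1 5 5 4 (by decide) (by omega) (by omega)
            (by omega) (by omega) ⟨by omega, by omega⟩) hr θ)

/-- ★★★★★ **LAW L OFF THE WALL, COMPLETE.** Hole `≥ 2` from every wall, ONE further cell `(x, y)` at Chebyshev distance
`≥ 2` from the hole, other than `farWW = (h.1 − 2, h.2)`, removed; if the cell is a ring cell (distance exactly `2`) it is
not a boundary cell of the box. Then nothing is killed (ring: `lawL_box_ring_offWall_not_killed`; distance `≥ 3`, on the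
wall or not: `lawL_box_not_killed_of_far`). So among single removals at distance `≥ 2` ONLY `farWW` (door closed,
`lawL_box_farWW_eq_zero`) and the ring cells ON a wall (`PlaquetteWalkHoleRootLawLWalls`) act on the far-cell vertex
functional's route structure. [cite: GlazmanManolescu2019, §1 (Fig. 2 and the remark after eq. (1)), §2.1, §4.2, Lemma 2.1]
[cite: Glazman2015WeightedSAW, Lemma 3.1 (proof, pp. 6–7)] [cite: CourantRobbins1958, Ch. V Appendix §2 (the even–odd rule)] -/
theorem lawL_box_offWall_not_killed (hW : 2 ≤ h.1) (hE : h.1 + 3 ≤ m) (hS : 2 ≤ h.2) (hN : h.2 + 3 ≤ n) {x y : ℤ}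
    (hfar : x + 2 ≤ h.1 ∨ h.1 + 2 ≤ x ∨ y + 2 ≤ h.2 ∨ h.2 + 2 ≤ y) (hWW : ¬(x = h.1 - 2 ∧ y = h.2))
    (hoff : (1 ≤ x ∧ x + 2 ≤ m ∧ 1 ≤ y ∧ y + 2 ≤ n) ∨ (x + 3 ≤ h.1 ∨ h.1 + 3 ≤ x ∨ y + 3 ≤ h.2 ∨ h.2 + 3 ≤ y))
    (hr : RootedFace (dom (boxMinus m n [h, (x, y)])) (Face.side (h.1 + 1, h.2) .W) (farW (h.1 + 1, h.2))) (θ : ℝ) :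
    (¬ ∀ (ω : ΩG (dom (boxMinus m n [h, (x, y)])) (Face.side (h.1 + 1, h.2) .W) (farW (h.1 + 1, h.2))) (hb : ω.IsB2a),
        ω.2.firstSideG = .S → ω.WE (fun _ => θ) ≠ excursionWinding θ ω.2.firstSideG (ω.z1 hr hb) ω.1 →
          ¬ω.2.W2FreeOff (farW (h.1 + 1, h.2))) ∧
      (¬ ∀ (ω : ΩG (dom (boxMinus m n [h, (x, y)])) (Face.side (h.1 + 1, h.2) .W) (farW (h.1 + 1, h.2))) (hb : ω.IsB2a),
        ω.2.firstSideG = .N → ω.WE (fun _ => θ) ≠ excursionWinding θ ω.2.firstSideG (ω.z1 hr hb) ω.1 →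
          ¬ω.2.W1FreeOff (farW (h.1 + 1, h.2))) ∧
      (¬ ∀ (ω : ΩG (dom (boxMinus m n [h, (x, y)])) (Face.side (h.1 + 1, h.2) .W) (farW (h.1 + 1, h.2))) (hb : ω.IsB2a),
        ω.2.firstSideG = .S → ω.WE (fun _ => θ) ≠ excursionWinding θ ω.2.firstSideG (ω.z1 hr hb) ω.1 →
          ¬ω.2.W1FreeOff (farW (h.1 + 1, h.2))) ∧
      (¬ ∀ (ω : ΩG (dom (boxMinus m n [h, (x, y)])) (Face.side (h.1 + 1, h.2) .W) (farW (h.1 + 1, h.2))) (hb : ω.IsB2a),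
        ω.2.firstSideG = .N → ω.WE (fun _ => θ) ≠ excursionWinding θ ω.2.firstSideG (ω.z1 hr hb) ω.1 →
          ¬ω.2.W2FreeOff (farW (h.1 + 1, h.2))) := by
  by_cases hnear : h.1 - 2 ≤ x ∧ x ≤ h.1 + 2 ∧ h.2 - 2 ≤ y ∧ y ≤ h.2 + 2
  · exact lawL_box_ring_offWall_not_killed hW hE hS hN (by omega) hWW (by omega) hr θ
  · refine lawL_box_not_killed_of_far (S := [h, (x, y)]) hW hE hS hN ?_ hr θ
    intro s hs
    simp only [List.mem_cons, List.not_mem_nil, or_false] at hs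
    rcases hs with rfl | rfl
    · exact Or.inl rfl
    · right; simp only [FarFromHole]; omega

end OffWall

end Literature.Barriers.CriticalPhenomena.PlaquetteWalk
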